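import Summits.ResolutionOfSingularities.ResolutionOfSingularities.Theorems.AQSHeightTwoSlopeFiltration
import Summits.ResolutionOfSingularities.ResolutionOfSingularities.Theorems.WeightedInvariantContactFiltrationCanonical
import HarnessLib

/-!
# Abramovich–Quek–Schober at a height-two point, II: comparing two contact parameters through the DVR `S/(y)`

Topic: `Summits/ResolutionOfSingularities/ResolutionOfSingularities/Theorems`. Helper for the door item
`HypersurfaceCentreConstruction` (statement `stmt-ResolutionOfSingularities-19897`, route `WeightedInvariant`), line
`local-engine`, ORDER (o25) «F-AQS-T in the kernel» of `res-L1-w43-plan-1` (2026-08-27T09:19:49Z), piece (α2) of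
`plan/tools/res-type-092/o25/O25-DESIGN.md` (res-type-092).  The one NEW lemma behind Abramovich–Quek–Schober's Thm 3.5
(maximality AND uniqueness of the lex-maximal centre) in the tree's currency; it generalises the key step C2
`ContactFiltration.mem_span_sup_pow_of_mem_contactFiltration` (res-type-078, p511384: integer slopes, any dimension) to
RATIONAL slopes in dimension two, with the same proof.

[OURS · L1 W4.3] Folklore (Hironaka 1967 / Cossart–Piltant / AQS Thm 3.5 proof (a)–(c)).  NOT a statement of the manuscript
under review (Hironaka 2017); nothing here is a claim about resolution of singularities.  AI work, weaker than expert review.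
Def-free.

## Content (`S` regular local of dimension `2`, `(x, y) = (x', y') = 𝔪`, `1 ≤ ν`, `f ∉ 𝔪^{ν+1}`,
`𝒥ₙ((x,y);(q,r)) := weightedMonomialIdeal ![x, y] ![q, r] n`)

* **`exists_order_ge`** (core): if `f ∈ 𝒥_{rν}((x,y);(q,r))` and `f ∈ 𝒥_{r'ν}((x',y');(q',r'))` with `1 < r'/q'` and
  `r/q ≤ r'/q'`, then `y' ∈ (y) + 𝔪^t` for some `t` with `q t ≥ r`.  Proof in `D = S/(y)` (regular local of dimension one):
  `f̄ ∈ 𝔪_D^⌈rν/q⌉`; `f = c y'^ν + f'`, `c` a unit, `f'` in the lower pieces; if `t = ord_D ȳ'` had `q t < r` (hence `q' t < r'`)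
  then `f̄'` and `f̄` would both lie in `𝔪_D^{νt+1}`, forcing `ȳ'^ν ∈ 𝔪_D^{νt+1}` — impossible.
* `exists_eq_unit_mul_add` — then `y' = a·y + h`, `a` a unit, `h ∈ 𝔪^t`.
* **`filtration_eq_of_mem_of_mem`** (AQS Thm 3.5 UNIQUENESS): two regular systems carrying `f` at the SAME slope `r/q > 1`
  define the same filtration `𝒥∙((·,·);(q,r))`.
* **`exists_steeper_of_not_dvd`** (AQS Thm 3.5 MAXIMALITY, non-integer slope): if `q ∤ r` and `y'` carries `f` at a STRICTLY
  larger slope `r'/q'`, then `y` itself carries `f` at some slope in `(r/q, r'/q']`.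
* `exists_steepen_form_of_le` — integer slope `b`: `y' ∈ (y) + 𝔪^t`, `t ≥ b ≥ 2` ⇒ `y' = a·(y - λ x^b)` with `a` a unit.

## References

* D. Abramovich, M. H. Quek, B. Schober, arXiv:2507.01232v3, Thm 3.5 and its proof (a)–(c), p. 7–9. [AbramovichQuekSchober2025]
* H. Hironaka, *Characteristic polyhedra of singularities*, J. Math. Kyoto Univ. 7 (1967). [Hironaka1967]
-/

noncomputable section

open IsLocalRing Literature.AlgebraicGeometry.Resolution

set_option linter.dupNamespace false -- mandated namespace of this single-conjunct summit

namespace Summit.ResolutionOfSingularities.ResolutionOfSingularities.Theorems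

namespace AQSHeightTwo

universe u

variable {S : Type u} [CommRing S]

/-! ### Arithmetic of `⌈a/q⌉ = (a + q - 1)/q` -/

/-- `q k < a ⇒ k + 1 ≤ ⌈a/q⌉`. [folklore] -/
theorem succ_le_cdiv_of_mul_lt {a q k : ℕ} (hq : 0 < q) (h : q * k < a) : k + 1 ≤ (a + q - 1) / q := by
  rw [Nat.le_div_iff_mul_le hq]
  have : (k + 1) * q = q * k + q := by ring
  omega

/-! ### The core comparison -/

section Core

variable [IsRegularLocalRing S]

/-- **Core comparison through `D = S/(y)`.**  `S` regular local of dimension two, `(x, y) = (x', y') = 𝔪`, `1 ≤ ν`,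
`f ∉ 𝔪^{ν+1}`; `f ∈ 𝒥_{rν}((x,y);(q,r))` (slope `r/q`, `q ≥ 1`) and `f ∈ 𝒥_{r'ν}((x',y');(q',r'))` (slope `r'/q' > 1`,
`q' ≥ 1`) with `r/q ≤ r'/q'`.  Then `y' ∈ (y) + 𝔪^t` for some `t` with `r ≤ q t`.
[cite: AbramovichQuekSchober2025, Thm 3.5 proof (a)–(c)] -/
theorem exists_order_ge (hdim : ringKrullDim S = (2 : ℕ)) {x y x' y' f : S}
    (hxy : Ideal.span {x, y} = maximalIdeal S) (hxy' : Ideal.span {x', y'} = maximalIdeal S)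
    {ν : ℕ} (hν : 1 ≤ ν) (hford : f ∉ maximalIdeal S ^ (ν + 1))
    {q r q' r' : ℕ} (hq : 0 < q) (hq' : 0 < q') (hlt' : q' < r') (hle : r * q' ≤ r' * q)
    (hf : f ∈ weightedMonomialIdeal ![x, y] ![q, r] (r * ν))
    (hf' : f ∈ weightedMonomialIdeal ![x', y'] ![q', r'] (r' * ν)) :
    ∃ t : ℕ, r ≤ q * t ∧ y' ∈ Ideal.span {y} ⊔ maximalIdeal S ^ t := by
  classical
  have hx : x ∈ maximalIdeal S := hxy ▸ Ideal.subset_span (by simp)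
  have hy : y ∈ maximalIdeal S := hxy ▸ Ideal.subset_span (by simp)
  have hx' : x' ∈ maximalIdeal S := hxy' ▸ Ideal.subset_span (by simp)
  have hy' : y' ∈ maximalIdeal S := hxy' ▸ Ideal.subset_span (by simp)
  have hy2 : y ∉ maximalIdeal S ^ 2 := (LocalGameEFTSteepening.not_mem_sq_of_span_pair_eq hdim hxy).2
  -- the quotient `D = S/(y)`, a regular local ring
  haveI hD : IsRegularLocalRing (S ⧸ Ideal.span {y}) := (IsRegularLocalRing.quotient_span_singleton hy hy2).1
  set mk : S →+* S ⧸ Ideal.span {y} := Ideal.Quotient.mk (Ideal.span {y}) with hmk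
  have hmkmax : (maximalIdeal S).map mk = maximalIdeal (S ⧸ Ideal.span {y}) :=
    IsLocalRing.map_maximalIdeal_of_surjective mk Ideal.Quotient.mk_surjective
  have hcomap : ∀ k : ℕ, (maximalIdeal (S ⧸ Ideal.span {y}) ^ k).comap mk = Ideal.span {y} ⊔ maximalIdeal S ^ k :=
    fun k => by
      rw [← hmkmax, ← Ideal.map_pow, Ideal.comap_map_of_surjective mk Ideal.Quotient.mk_surjective,
        ← RingHom.ker_eq_comap_bot, hmk, Ideal.mk_ker, sup_comm]
  -- if `y' ∈ (y)` any large `t` will do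
  by_cases hzero : mk y' = 0
  · rw [Ideal.Quotient.eq_zero_iff_mem] at hzero
    exact ⟨r, Nat.le_mul_of_pos_left r hq, Ideal.mem_sup_left hzero⟩
  -- the order `t` of `ȳ'`
  obtain ⟨t, ht⟩ := ENat.ne_top_iff_exists.mp (adicOrder_ne_top hzero)
  have htmem : mk y' ∈ maximalIdeal (S ⧸ Ideal.span {y}) ^ t := (le_adicOrder_iff _ _).mp ht.le
  have htnot : mk y' ∉ maximalIdeal (S ⧸ Ideal.span {y}) ^ (t + 1) := (adicOrder_le_iff _ _).mp ht.ge
  refine ⟨t, ?_, by rw [← hcomap t, Ideal.mem_comap]; exact htmem⟩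
  by_contra hqt
  push Not at hqt
  -- then also `q' t < r'`
  have hqt' : q' * t < r' := by
    have h1 : q' * (q * t) < q' * r := Nat.mul_lt_mul_of_pos_left hqt hq'
    have h2 : q' * r ≤ r' * q := by rw [Nat.mul_comm]; exact hle
    have h3 : q * (q' * t) < q * r' := by nlinarith
    exact Nat.lt_of_mul_lt_mul_left h3
  -- the lower pieces `I'` of the `y'`-filtration, and `f = c y'^ν + f'`
  set I' : Ideal S := ⨆ j, ⨆ (_ : j < ν), Ideal.span {y' ^ j} * maximalIdeal S ^ ((r' * (ν - j) + q' - 1) / q')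
    with hI'
  have hsplit : f ∈ Ideal.span {y' ^ ν} ⊔ I' := le_span_pow_sup_iSup hx' y' hq' r' ν hf'
  have hI'le : I' ≤ maximalIdeal S ^ (ν + 1) := by
    rw [hI']
    refine iSup_le fun j => iSup_le fun hj => ?_
    have h1 : Ideal.span {y' ^ j} ≤ maximalIdeal S ^ j := by
      rw [Ideal.span_singleton_le_iff_mem]; exact Ideal.pow_mem_pow hy' j
    refine le_trans (Ideal.mul_mono_left h1) ?_
    rw [← pow_add]
    refine Ideal.pow_le_pow_right ?_
    -- `⌈r'(ν-j)/q'⌉ ≥ (ν - j) + 1` since `r' > q'`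
    have hk : (ν - j) + 1 ≤ (r' * (ν - j) + q' - 1) / q' :=
      succ_le_cdiv_of_mul_lt hq' (Nat.mul_lt_mul_of_pos_right hlt' (by omega))
    omega
  obtain ⟨a, ha, f', hf'I, haf⟩ := Submodule.mem_sup.mp hsplit
  obtain ⟨c, rfl⟩ := Ideal.mem_span_singleton'.mp ha
  -- `c` is a unit
  have hc : IsUnit c := by
    by_contra hcu
    have hcm : c ∈ maximalIdeal S := (IsLocalRing.mem_maximalIdeal _).mpr hcu
    apply hford
    rw [← haf]
    refine Ideal.add_mem _ ?_ (hI'le hf'I)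
    rw [pow_succ']
    exact Ideal.mul_mem_mul hcm (Ideal.pow_mem_pow hy' ν)
  -- in `D`: `f̄ ∈ 𝔪_D^{νt+1}` (only the `x`-axis of the `y`-filtration survives, at height `⌈rν/q⌉ > νt`)
  have hνt : ν * t + 1 ≤ (r * ν + q - 1) / q :=
    succ_le_cdiv_of_mul_lt hq (by nlinarith)
  have hfD : mk f ∈ maximalIdeal (S ⧸ Ideal.span {y}) ^ (ν * t + 1) := by
    refine Ideal.pow_le_pow_right hνt ?_
    rw [← Ideal.mem_comap, hcomap]
    exact le_span_sup_pow_cdiv hx y hq r (r * ν) hf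
  -- in `D`: `f̄' ∈ 𝔪_D^{νt+1}` (`ȳ'^j ∈ 𝔪_D^{tj}` and `⌈r'(ν-j)/q'⌉ ≥ t(ν-j) + 1`)
  have hI'D : I'.map mk ≤ maximalIdeal (S ⧸ Ideal.span {y}) ^ (ν * t + 1) := by
    rw [hI', Ideal.map_iSup]
    refine iSup_le fun j => ?_
    rw [Ideal.map_iSup]
    refine iSup_le fun hj => ?_
    rw [Ideal.map_mul, Ideal.map_pow, hmkmax, Ideal.map_span, Set.image_singleton, map_pow]
    have h1 : Ideal.span {mk y' ^ j} ≤ maximalIdeal (S ⧸ Ideal.span {y}) ^ (t * j) := by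
      rw [Ideal.span_singleton_le_iff_mem, pow_mul]
      exact Ideal.pow_mem_pow htmem j
    refine le_trans (Ideal.mul_mono_left h1) ?_
    rw [← pow_add]
    refine Ideal.pow_le_pow_right ?_
    have hk : t * (ν - j) + 1 ≤ (r' * (ν - j) + q' - 1) / q' := by
      refine succ_le_cdiv_of_mul_lt hq' ?_
      have : 0 < ν - j := by omega
      nlinarith
    have e : t * j + t * (ν - j) = t * ν := by rw [← Nat.mul_add, Nat.add_sub_cancel' hj.le]
    have e' : ν * t = t * ν := Nat.mul_comm _ _
    omega
  -- hence `c̄ ȳ'^ν ∈ 𝔪_D^{νt+1}`, i.e. `ȳ'^ν ∈ 𝔪_D^{νt+1}`: contradiction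
  have hcg : mk (c * y' ^ ν) ∈ maximalIdeal (S ⧸ Ideal.span {y}) ^ (ν * t + 1) := by
    have : mk (c * y' ^ ν) = mk f - mk f' := by rw [← haf, map_add, add_sub_cancel_right]
    rw [this]
    exact Ideal.sub_mem _ hfD (hI'D (Ideal.mem_map_of_mem mk hf'I))
  have hgν : mk y' ^ ν ∈ maximalIdeal (S ⧸ Ideal.span {y}) ^ (ν * t + 1) := by
    rw [map_mul, map_pow] at hcg
    obtain ⟨u, hu⟩ := hc.map mk
    have := Ideal.mul_mem_left _ (↑u⁻¹ : S ⧸ Ideal.span {y}) hcg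
    rwa [← mul_assoc, ← hu, Units.inv_mul, one_mul] at this
  exact ContactFiltration.pow_not_mem_pow_of_not_mem_pow htnot ν hgν

/-- From `y' ∈ (y) + 𝔪^t` with `t ≥ 2` and `y'` a regular parameter (`(x', y') = 𝔪`): `y' = a·y + h` with `a` a unit and
`h ∈ 𝔪^t`. [folklore] -/
theorem exists_eq_unit_mul_add (hdim : ringKrullDim S = (2 : ℕ)) {y x' y' : S}
    (hxy' : Ideal.span {x', y'} = maximalIdeal S) (hy : y ∈ maximalIdeal S) {t : ℕ} (ht : 2 ≤ t)
    (hmem : y' ∈ Ideal.span {y} ⊔ maximalIdeal S ^ t) :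
    ∃ a h : S, IsUnit a ∧ h ∈ maximalIdeal S ^ t ∧ y' = a * y + h := by
  obtain ⟨s, hs, h, hh, rfl⟩ := Submodule.mem_sup.mp hmem
  obtain ⟨a, rfl⟩ := Ideal.mem_span_singleton'.mp hs
  refine ⟨a, h, ?_, hh, rfl⟩
  by_contra ha
  have hy'2 : a * y + h ∉ maximalIdeal S ^ 2 := (LocalGameEFTSteepening.not_mem_sq_of_span_pair_eq hdim hxy').2
  apply hy'2
  refine Ideal.add_mem _ ?_ (Ideal.pow_le_pow_right ht hh)
  rw [pow_two]
  exact Ideal.mul_mem_mul ((IsLocalRing.mem_maximalIdeal _).mpr ha) hy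

/-- **AQS Thm 3.5, UNIQUENESS of the Rees filtration.**  If two regular systems `(x, y)`, `(x', y')` of the two-dimensional
regular local ring `S` both carry `f ∉ 𝔪^{ν+1}` (`ν ≥ 1`) at the same slope `r/q > 1` — `f ∈ 𝒥_{rν}((x,y);(q,r))` and
`f ∈ 𝒥_{rν}((x',y');(q,r))` — then `𝒥ₙ((x',y');(q,r)) = 𝒥ₙ((x,y);(q,r))` for every `n`.
[cite: AbramovichQuekSchober2025, Thm 3.5 proof (c)] -/
theorem filtration_eq_of_mem_of_mem (hdim : ringKrullDim S = (2 : ℕ)) {x y x' y' f : S}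
    (hxy : Ideal.span {x, y} = maximalIdeal S) (hxy' : Ideal.span {x', y'} = maximalIdeal S)
    {ν : ℕ} (hν : 1 ≤ ν) (hford : f ∉ maximalIdeal S ^ (ν + 1))
    {q r : ℕ} (hq : 0 < q) (hqr : q < r)
    (hf : f ∈ weightedMonomialIdeal ![x, y] ![q, r] (r * ν))
    (hf' : f ∈ weightedMonomialIdeal ![x', y'] ![q, r] (r * ν)) (n : ℕ) :
    weightedMonomialIdeal ![x', y'] ![q, r] n = weightedMonomialIdeal ![x, y] ![q, r] n := by
  have hy : y ∈ maximalIdeal S := hxy ▸ Ideal.subset_span (by simp)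
  obtain ⟨t, hrt, hmem⟩ := exists_order_ge hdim hxy hxy' hν hford hq hq hqr le_rfl hf hf'
  have ht2 : 2 ≤ t := by
    by_contra h
    push Not at h
    interval_cases t <;> omega
  obtain ⟨a, h, ha, hh, rfl⟩ := exists_eq_unit_mul_add hdim hxy' hy ht2 hmem
  have hxay : Ideal.span {x, a * y + h} = maximalIdeal S :=
    span_pair_eq_of_unit_mul_add hxy ha (Ideal.pow_le_pow_right ht2 hh)
  rw [eq_of_fst hxay hxy' hqr.le n, eq_of_snd_eq_unit_mul_add hxy ha ht2 hh hqr.le hrt n]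

/-- **AQS Thm 3.5, MAXIMALITY at a non-integer slope.**  If `(x, y)` carries `f ∉ 𝔪^{ν+1}` at the slope `r/q` with `q ∤ r`
(`q ≥ 1`, `r > q`) and another regular system `(x', y')` carries it at a STRICTLY larger slope `r'/q'` (`q' ≥ 1`), then
`(x, y)` ITSELF carries `f` at a slope `r''/q'' ∈ (r/q, r'/q']`.  (So a slope that is maximal among the slopes of `y` and not an
integer is maximal over all regular systems.) [cite: AbramovichQuekSchober2025, Thm 3.5 proof (a)–(b)] -/
theorem exists_steeper_of_not_dvd (hdim : ringKrullDim S = (2 : ℕ)) {x y x' y' f : S}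
    (hxy : Ideal.span {x, y} = maximalIdeal S) (hxy' : Ideal.span {x', y'} = maximalIdeal S)
    {ν : ℕ} (hν : 1 ≤ ν) (hford : f ∉ maximalIdeal S ^ (ν + 1))
    {q r q' r' : ℕ} (hq : 0 < q) (hqr : q < r) (hndvd : ¬ q ∣ r) (hq' : 0 < q') (hlt : r * q' < r' * q)
    (hf : f ∈ weightedMonomialIdeal ![x, y] ![q, r] (r * ν))
    (hf' : f ∈ weightedMonomialIdeal ![x', y'] ![q', r'] (r' * ν)) :
    ∃ q'' r'' : ℕ, 0 < q'' ∧ r * q'' < r'' * q ∧ r'' * q' ≤ r' * q'' ∧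
      f ∈ weightedMonomialIdeal ![x, y] ![q'', r''] (r'' * ν) := by
  have hy : y ∈ maximalIdeal S := hxy ▸ Ideal.subset_span (by simp)
  have hlt' : q' < r' := by
    -- `r'/q' > r/q > 1`
    by_contra h
    push Not at h
    have : r' * q ≤ q' * q := Nat.mul_le_mul_right _ h
    nlinarith
  obtain ⟨t, hrt, hmem⟩ := exists_order_ge hdim hxy hxy' hν hford hq hq' hlt' hlt.le hf hf'
  -- `q t > r` since `q ∤ r`
  have hrt' : r < q * t := by
    rcases hrt.lt_or_eq with h | h
    · exact h
    · exact absurd ⟨t, h⟩ hndvd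
  have ht2 : 2 ≤ t := by
    by_contra h
    push Not at h
    interval_cases t <;> omega
  obtain ⟨a, h, ha, hh, rfl⟩ := exists_eq_unit_mul_add hdim hxy' hy ht2 hmem
  have hxay : Ideal.span {x, a * y + h} = maximalIdeal S :=
    span_pair_eq_of_unit_mul_add hxy ha (Ideal.pow_le_pow_right ht2 hh)
  -- read `hf'` with the transversal parameter `x`
  have hf'' : f ∈ weightedMonomialIdeal ![x, a * y + h] ![q', r'] (r' * ν) := by
    rw [← eq_of_fst hxay hxy' hlt'.le]; exact hf'
  by_cases hcase : r' ≤ q' * t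
  · -- the slope `r'/q'` itself transfers to `y`
    refine ⟨q', r', hq', hlt, le_rfl, ?_⟩
    rwa [eq_of_snd_eq_unit_mul_add hxy ha ht2 hh hlt'.le hcase] at hf''
  · -- the integer slope `t < r'/q'` transfers to `y`
    push Not at hcase
    refine ⟨1, t, one_pos, by rw [Nat.mul_one, Nat.mul_comm]; exact hrt', by simpa [Nat.mul_comm] using hcase.le, ?_⟩
    have h1 : f ∈ weightedMonomialIdeal ![x, a * y + h] ![1, t] (t * ν) :=
      slope_antitone x (a * y + h) hq' (by simpa [Nat.mul_comm] using hcase.le) ν hf''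
    rwa [eq_of_snd_eq_unit_mul_add hxy ha ht2 hh (by omega) (by simp) ] at h1

/-- **Integer slope: the steepening form.**  If `y' ∈ (y) + 𝔪^t` with `t ≥ b ≥ 2`, `(x, y) = 𝔪` and `y'` is a regular
parameter, then `y' = a·(y - λ x^b)` for a unit `a` and some `λ ∈ S` (in coordinates `(x, y)`: `𝔪^b = (x^b) + y 𝔪^{b-1}`).
[cite: AbramovichQuekSchober2025, Thm 3.5 proof (b)] -/
theorem exists_steepen_form_of_le (hdim : ringKrullDim S = (2 : ℕ)) {x y x' y' : S}
    (hxy : Ideal.span {x, y} = maximalIdeal S) (hxy' : Ideal.span {x', y'} = maximalIdeal S)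
    {b t : ℕ} (hb : 2 ≤ b) (hbt : b ≤ t) (hmem : y' ∈ Ideal.span {y} ⊔ maximalIdeal S ^ t) :
    ∃ a lam : S, IsUnit a ∧ y' = a * (y - lam * x ^ b) := by
  have hy : y ∈ maximalIdeal S := hxy ▸ Ideal.subset_span (by simp)
  have ht2 : 2 ≤ t := hb.trans hbt
  obtain ⟨a, h, ha, hh, rfl⟩ := exists_eq_unit_mul_add hdim hxy' hy ht2 hmem
  -- `h ∈ 𝔪^b = (x, y)^b ⊆ (y^?) …`: write `h ∈ (y) 𝔪 + (x^b)` using `𝔪^b ⊆ J_b(b)((x,y);(1,b)) ⊆ (y, x^b)`… we use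
  -- `𝔪^b ⊆ (y^1, x^b)` in the form of `weightedMonomialIdeal_le_span_pair` with `ν = 1`
  have hb1 : 1 ≤ b := by omega
  have hhb : h ∈ maximalIdeal S ^ b := Ideal.pow_le_pow_right hbt hh
  have hJ : h ∈ weightedMonomialIdeal ![x, y] ![1, b] (b * 1) := by
    rw [mul_one]; exact LocalGameEFTSteepening.span_pair_pow_le x y hb1 b (hxy ▸ hhb)
  have hpair := LocalGameEFTSteepening.weightedMonomialIdeal_le_span_pair x y b 1 hJ
  rw [pow_one] at hpair
  obtain ⟨s, c, hsc⟩ := Ideal.mem_span_pair.mp hpair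
  -- `a y + h = (a + s) y + c x^b`, and `a + s` is a unit?  `s` need not lie in `𝔪`; but `h ∈ 𝔪² ` and `x^b ∈ 𝔪^b` force
  -- `s y ∈ 𝔪²`, whence `s ∈ 𝔪` (as `y ∉ 𝔪²`): we argue via units directly on `a + s`.
  have hy2 : y ∉ maximalIdeal S ^ 2 := (LocalGameEFTSteepening.not_mem_sq_of_span_pair_eq hdim hxy).2
  have hx : x ∈ maximalIdeal S := hxy ▸ Ideal.subset_span (by simp)
  have hs : s ∈ maximalIdeal S := by
    by_contra hsu
    have hsunit : IsUnit s := by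
      by_contra h'
      exact hsu ((IsLocalRing.mem_maximalIdeal _).mpr h')
    have hsy : s * y = h - c * x ^ b := by rw [← hsc]; ring
    have hmem2 : s * y ∈ maximalIdeal S ^ 2 := by
      rw [hsy]
      refine Ideal.sub_mem _ (Ideal.pow_le_pow_right ht2 hh) (Ideal.mul_mem_left _ _ ?_)
      exact Ideal.pow_le_pow_right hb (Ideal.pow_mem_pow hx b)
    obtain ⟨u, rfl⟩ := hsunit
    apply hy2
    have := Ideal.mul_mem_left _ (↑u⁻¹ : S) hmem2
    rwa [← mul_assoc, Units.inv_mul, one_mul] at this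
  have hunit : IsUnit (a + s) := by
    by_contra hnu
    have hmem : a + s ∈ maximalIdeal S := (IsLocalRing.mem_maximalIdeal _).mpr hnu
    have : a ∈ maximalIdeal S := by simpa using Ideal.sub_mem _ hmem hs
    exact (IsLocalRing.mem_maximalIdeal _).mp this ha
  obtain ⟨w, hw⟩ := hunit
  refine ⟨w, -(↑w⁻¹ * c), w.isUnit, ?_⟩
  have e : a * y + h = (a + s) * y + c * x ^ b := by rw [← hsc]; ring
  rw [e, ← hw]
  have : (w : S) * (y - -(↑w⁻¹ * c) * x ^ b) = (w : S) * y + ((w : S) * ↑w⁻¹) * (c * x ^ b) := by ring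
  rw [this, Units.mul_inv, one_mul]

end Core

end AQSHeightTwo

end Summit.ResolutionOfSingularities.ResolutionOfSingularities.Theorems

end
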